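import Mathlib
import Literature.MathematicalPhysics.PowerSystems.SinusoidalCouplingSectorBound
import Literature.MathematicalPhysics.PowerSystems.StructurePreservingModel
import HarnessLib

/-!
# Uniqueness of the synchronous equilibrium in the phase-cohesive polytope (lossless networks)
# (Araposthatis–Sastry–Varaiya 1981 Cor. 1, via Dörfler–Chertkov–Bullo 2013 SI Lemma 2;
#  Dvijotham–Low–Chertkov 2015 Thm 3.3 / Cor. 1; Vu–Turitsyn 2016 App. 9.2)

Topic `Literature/MathematicalPhysics/PowerSystems`, namespaces
`Literature.MathematicalPhysics.PowerSystems.{SinusoidalCoupling, ClassicalModel, BergenHill}`.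
Everything below is PROVED from Mathlib and the two imported tree files (no named facts, no new
axioms); the two `def`s are the printed graph-connectivity hypotheses, spelled as cut conditions.

Sources (held, read this session; locators are chunk files of the materialised texts):
* F. Dörfler, M. Chertkov, F. Bullo, *Synchronization in complex oscillator networks and smart
  grids*, PNAS 110 (2013) 2005–2010, Supporting Information §3.1 [DorflerChertkovBullo2013;
  arXiv:1208.0045, chunk p0016], **Lemma 2 (Stable synchronization in Δ_G(π/2))**:
  > «Consider the Kuramoto model … with a connected graph G(V,E,A), and let γ ∈ [0,π/2[. The
  > following statements hold: 1) Jacobian: The Jacobian of the Kuramoto model evaluated at θ is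
  > given by J(θ) = −B diag({a_ij cos(θ_i − θ_j)}_{{i,j}∈E}) Bᵀ; 2) Stability: If there exists an
  > equilibrium point θ* ∈ Δ̄_G(γ), then it belongs to a locally exponentially stable equilibrium
  > manifold [θ*] ∈ Δ̄_G(γ); and 3) Uniqueness: This equilibrium manifold is unique in Δ̄_G(γ).»
  > Proof of 3): «The uniqueness statement 3) follows since the right-hand side of [the fixed-point
  > equations ω_i = Σ_j a_ij sin(θ_i − θ_j)] is a one-to-one function for θ ∈ Δ̄_G(π/2), see
  > [Corollary 1] AA-SS-VP:81» — the PRIMARY, A. Araposthatis, S. Sastry, P. Varaiya, *Analysis of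
  > power-flow equation*, Int. J. Electr. Power Energy Syst. 3 (1981) 115–126
  > [AraposthatisSastryVaraiya1981], is not held (cite-only; `lit want` filed).
* K. Dvijotham, S. Low, M. Chertkov, *Convexity of energy-like functions: theoretical results and
  applications to power system operations*, arXiv:1501.04052 (2015) [DvijothamLowChertkov2015,
  chunks p0007–p0008], **Theorem 3.3** (energy function jointly convex on
  `|θ_i − θ_j| ≤ π/2 ∀ (i,j) ∈ E`; «if there are no (P,Q) nodes … the convexity condition reduces to
  requiring that all phase differences (over existing lines) are smaller than π/2») and
  **Corollary 1**, last sentence of the proof: «by strict convexity of the energy function … there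
  can be at most one stationary point of E in Int(C), and hence, the power flow solution, if it
  exists, is unique» (slack bus pinned: `θ_S = 0`).
* T. L. Vu, K. Turitsyn, IEEE TPWRS 31 (2016) [VuTuritsyn2016; arXiv:1409.1889 chunk p0005]:
  «this point, characterized by the rotor angles δ*_k is not unique, as any uniform shift of the
  rotor angles δ*_k → δ*_k + c is also an equilibrium. However, it is unambiguously characterized
  by the angle differences δ*_kj»; chunk p0008: the polytope `P = {|δ_kj + δ*_kj| < π}`; App. 9.2
  (chunk p0015): «from x₀ the system converges to the stable equilibrium δ* or to some stationary
  point x* lying on the boundary of P» — i.e. `δ*` is the only stationary point INSIDE `P`, which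
  is theorem `lineAngles_eq_of_equilibria_sectorPolytope` below.

## Rendering (tree vocabulary of `LosslessMultimachineEnergy.lean`, unbundled)

Angles are REAL LIFTS `θ : Fin n → ℝ` (not points of the torus), exactly as in every model file of
this topic; a «line» is an ordered pair `i ≠ j` with coupling `0 < C i j` (`C i j = a_ij =
E_iE_jB_ij`, symmetric, off-diagonal entries `≥ 0`; the diagonal is unconstrained and harmless
since `sin 0 = 0`).  The lossless active-power flow map is `F_i(θ) = Σ_j C_ij sin(θ_i − θ_j)` and a
synchronous equilibrium / power-flow solution for injections `P` is `F(θ) = P`.  The closed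
phase-cohesive polytope `Δ̄_G(π/2)` is `|θ_i − θ_j| ≤ π/2` on lines.

* CORE (monotone-operator form of «one-to-one on Δ̄_G(π/2)»): the pairing identity
  `Σ_i (θ'_i − θ_i)(F_i(θ') − F_i(θ)) = ½ Σ_i Σ_j C_ij ((θ'_i−θ'_j) − (θ_i−θ_j))(sin(θ'_i−θ'_j) − sin(θ_i−θ_j))`
  (`flow_pairing_eq`), whose right side is a sum of NONNEGATIVE terms on `Δ̄_G(π/2) × Δ̄_G(π/2)`
  (strict monotonicity of `sin` on `[−π/2, π/2]`), each vanishing only when the two line angles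
  agree.  Hence two equilibria in `Δ̄_G(π/2)` have THE SAME ANGLE ACROSS EVERY LINE
  (`lineAngles_eq_of_equilibria_phaseCohesive`) — no connectivity needed for this form — and, for
  a connected coupling graph, differ by a uniform rotation (`equilibrium_unique_mod_rotation`,
  statement 3) as printed); pinning one reference angle, or coupling to ≥ 1 infinite bus through a
  connected graph, makes the equilibrium unique outright (`equilibrium_unique_of_reference`,
  `equilibrium_unique_withInfiniteBuses` — the `n`-machine form of the `∃!` proved ad hoc for
  Chiang's 3-machine system in `ChiangThreeMachineRegionOfAttraction.lean`).
* The same argument on Vu–Turitsyn's wider polytope: if `θ*` is an equilibrium with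
  `|θ*_i − θ*_j| < π/2` on lines, any equilibrium `θ` with `|(θ_i−θ_j) + (θ*_i−θ*_j)| < π` on lines
  has the same line angles (`lineAngles_eq_of_equilibria_sectorPolytope`; the sector inequality is
  the tree's `SinusoidalCoupling.sector_nonneg`, its equality case `sector_pos_of_abs_add_lt` is
  proved here).
* Statement 1) in coordinates: the quadratic form of the negative Jacobian is the weighted
  Laplacian form `Σ_i v_i Σ_j C_ij cos(θ_i−θ_j)(v_i − v_j) = ½ Σ_i Σ_j C_ij cos(θ_i−θ_j)(v_i−v_j)²`,
  nonnegative on `Δ̄_G(π/2)` (`jacobian_quadraticForm_eq`, `jacobian_quadraticForm_nonneg`).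
  Statement 2) (local exponential stability of the manifold) is linearisation theory and is NOT
  typed here.
* Corollary for the tree's Bergen–Hill record (`StructurePreservingModel.lean`, lit-2):
  `BergenHill.isEquilibrium_unique_mod_rotation`.

REMARK (scope, kernel-checked in the `example` at the end of namespace `ClassicalModel`): the statement is about real angle
vectors with REAL line differences `|θ_i − θ_j| ≤ π/2`.  Read on the torus (geodesic differences) it
fails on cycles: for 5 identical uncoupled-frequency oscillators on a ring (`P = 0`, unit
couplings) the splay state `θ_i = 2πi/5` is an equilibrium whose geodesic line gaps are all
`2π/5 < π/2`, yet it is not a rotation of the synchronous state `θ = 0`; as a real lift its closing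
line has `|θ_4 − θ_0| = 8π/5 > π/2`, so the theorems below do not apply to it — consistent, and the
reason every ROA statement of this topic recovers angles as real lifts near the s.e.p.

MODELLED: lossless (zero transfer conductances), constant voltage magnitudes; with transfer
conductances the flow map is not monotone and none of this is claimed.  No statement below says a
grid is stable; uniqueness of the equilibrium is the ingredient that turns «converges to the set of
equilibria in the well» (LaSalle) into «converges to δ*» in the energy / LFF / quadratic
certificate tiers.
-/

namespace Literature.MathematicalPhysics.PowerSystems

open Real Finset

/-! ## One-dimensional monotonicity of `sin` (equality cases of the sector bounds) -/

namespace SinusoidalCoupling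

/-- On `[−π/2, π/2]` the sine is increasing: `(b − a)(sin b − sin a) ≥ 0` — the scalar case of
«the right-hand side is one-to-one on Δ̄_G(π/2)».
[cite: DorflerChertkovBullo2013, SI §3.1 Lemma 2 (3), proof (one-to-one on Δ̄_G(π/2)); scalar case] -/
theorem sub_mul_sin_sub_nonneg {a b : ℝ} (ha : |a| ≤ π / 2) (hb : |b| ≤ π / 2) :
    0 ≤ (b - a) * (Real.sin b - Real.sin a) := by
  have ha' : a ∈ Set.Icc (-(π / 2)) (π / 2) := ⟨by linarith [abs_le.mp ha |>.1], (abs_le.mp ha).2⟩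
  have hb' : b ∈ Set.Icc (-(π / 2)) (π / 2) := ⟨by linarith [abs_le.mp hb |>.1], (abs_le.mp hb).2⟩
  rcases lt_trichotomy a b with hab | hab | hab
  · have := Real.strictMonoOn_sin ha' hb' hab
    exact mul_nonneg (by linarith) (by linarith)
  · subst hab; simp
  · have := Real.strictMonoOn_sin hb' ha' hab
    exact mul_nonneg_of_nonpos_of_nonpos (by linarith) (by linarith)

/-- On `[−π/2, π/2]` the sine is STRICTLY increasing: `a ≠ b ⇒ (b − a)(sin b − sin a) > 0` — the
equality case used for uniqueness in `Δ̄_G(π/2)`.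
[cite: DorflerChertkovBullo2013, SI §3.1 Lemma 2 (3), proof (one-to-one on Δ̄_G(π/2)); scalar case] -/
theorem sub_mul_sin_sub_pos {a b : ℝ} (ha : |a| ≤ π / 2) (hb : |b| ≤ π / 2) (hne : a ≠ b) :
    0 < (b - a) * (Real.sin b - Real.sin a) := by
  have ha' : a ∈ Set.Icc (-(π / 2)) (π / 2) := ⟨by linarith [abs_le.mp ha |>.1], (abs_le.mp ha).2⟩
  have hb' : b ∈ Set.Icc (-(π / 2)) (π / 2) := ⟨by linarith [abs_le.mp hb |>.1], (abs_le.mp hb).2⟩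
  rcases lt_or_gt_of_ne hne with hab | hab
  · have := Real.strictMonoOn_sin ha' hb' hab
    exact mul_pos (by linarith) (by linarith)
  · have := Real.strictMonoOn_sin hb' ha' hab
    exact mul_pos_of_neg_of_neg (by linarith) (by linarith)

/-- Equality case of the tree's sector bound `sector_nonneg` on Vu–Turitsyn's polytope: for
`|δs| < π/2` and `|δ + δs| < π`, `(δ − δs)(sin δ − sin δs) > 0` unless `δ = δs`.
(`sin δ − sin δs = 2 sin((δ−δs)/2) cos((δ+δs)/2)` with `cos((δ+δs)/2) > 0` and
`0 < |δ − δs| < 2π`.) [cite: VuTuritsyn2016, §II sector-bound display and App. 9.2] -/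
theorem sector_pos_of_abs_add_lt {δ δs : ℝ} (hδs : |δs| < π / 2) (hP : |δ + δs| < π)
    (hne : δ ≠ δs) : 0 < (δ - δs) * (Real.sin δ - Real.sin δs) := by
  have hcos : 0 < Real.cos ((δ + δs) / 2) := by
    apply Real.cos_pos_of_mem_Ioo
    constructor <;> [linarith [(abs_lt.mp hP).1]; linarith [(abs_lt.mp hP).2]]
  have hu_ne : (δ - δs) / 2 ≠ 0 := by
    intro h; apply hne; linarith
  have hu_lt : |(δ - δs) / 2| < π := by
    have h1 : |δ - δs| ≤ |δ + δs| + 2 * |δs| := by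
      have : δ - δs = (δ + δs) - 2 * δs := by ring
      rw [this]
      calc |(δ + δs) - 2 * δs| ≤ |δ + δs| + |2 * δs| := abs_sub _ _
        _ = |δ + δs| + 2 * |δs| := by rw [abs_mul]; norm_num
    rw [abs_div, abs_two]
    linarith
  -- u · sin u > 0 for 0 < |u| < π
  have husin : 0 < (δ - δs) / 2 * Real.sin ((δ - δs) / 2) := by
    rcases lt_or_gt_of_ne hu_ne with hu | hu
    · have : Real.sin ((δ - δs) / 2) < 0 := by
        have hlt : -((δ - δs) / 2) < π := by linarith [(abs_lt.mp hu_lt).1]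
        have := Real.sin_pos_of_pos_of_lt_pi (by linarith) hlt
        rw [Real.sin_neg] at this; linarith
      exact mul_pos_of_neg_of_neg hu this
    · have : 0 < Real.sin ((δ - δs) / 2) :=
        Real.sin_pos_of_pos_of_lt_pi hu (by linarith [(abs_lt.mp hu_lt).2])
      exact mul_pos hu this
  have hsub : Real.sin δ - Real.sin δs
      = 2 * Real.sin ((δ - δs) / 2) * Real.cos ((δ + δs) / 2) := Real.sin_sub_sin δ δs
  rw [hsub]
  have : (δ - δs) * (2 * Real.sin ((δ - δs) / 2) * Real.cos ((δ + δs) / 2))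
      = 4 * (((δ - δs) / 2) * Real.sin ((δ - δs) / 2)) * Real.cos ((δ + δs) / 2) := by ring
  rw [this]
  positivity

end SinusoidalCoupling

/-! ## The lossless flow map is monotone on the phase-cohesive polytope -/

namespace ClassicalModel

variable {n m : ℕ}

/-- **Pairing (symmetrisation) identity** behind «the right-hand side is one-to-one on Δ̄_G(π/2)»:
for symmetric couplings `C`,
`Σ_i (θ'_i − θ_i)(F_i(θ') − F_i(θ)) = ½ Σ_i Σ_j C_ij ((θ'_i−θ'_j) − (θ_i−θ_j))(sin(θ'_i−θ'_j) − sin(θ_i−θ_j))`,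
`F_i(θ) = Σ_j C_ij sin(θ_i − θ_j)` — the identity form of «the right-hand side is one-to-one on
Δ̄_G(π/2)» (monotonicity of the lossless flow map).
[cite: DorflerChertkovBullo2013, SI §3.1 Lemma 2 (3), proof (one-to-one on Δ̄_G(π/2))] -/
theorem flow_pairing_eq (C : Fin n → Fin n → ℝ) (hC : ∀ i j, C i j = C j i)
    (θ θ' : Fin n → ℝ) :
    ∑ i, (θ' i - θ i) * (∑ j, C i j * Real.sin (θ' i - θ' j) - ∑ j, C i j * Real.sin (θ i - θ j))
      = 1 / 2 * ∑ i, ∑ j, C i j * (((θ' i - θ' j) - (θ i - θ j))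
          * (Real.sin (θ' i - θ' j) - Real.sin (θ i - θ j))) := by
  -- write the left side as Σ_i Σ_j C_ij g_ij d_i with g antisymmetric, d = θ' − θ
  set d : Fin n → ℝ := fun i => θ' i - θ i with hd
  set g : Fin n → Fin n → ℝ := fun i j => Real.sin (θ' i - θ' j) - Real.sin (θ i - θ j) with hg
  have hanti : ∀ i j, C i j * g i j = -(C j i * g j i) := by
    intro i j
    simp only [hg]
    rw [show θ' j - θ' i = -(θ' i - θ' j) by ring, show θ j - θ i = -(θ i - θ j) by ring,
      Real.sin_neg, Real.sin_neg, hC j i]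
    ring
  have hL : ∑ i, (θ' i - θ i) * (∑ j, C i j * Real.sin (θ' i - θ' j)
      - ∑ j, C i j * Real.sin (θ i - θ j)) = ∑ i, ∑ j, C i j * g i j * d i := by
    refine Finset.sum_congr rfl fun i _ => ?_
    rw [← Finset.sum_sub_distrib, Finset.mul_sum]
    refine Finset.sum_congr rfl fun j _ => ?_
    simp only [hg, hd]; ring
  have hR : 1 / 2 * ∑ i, ∑ j, C i j * (((θ' i - θ' j) - (θ i - θ j))
      * (Real.sin (θ' i - θ' j) - Real.sin (θ i - θ j)))
      = 1 / 2 * (∑ i, ∑ j, C i j * g i j * d i - ∑ i, ∑ j, C i j * g i j * d j) := by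
    congr 1
    rw [← Finset.sum_sub_distrib]
    refine Finset.sum_congr rfl fun i _ => ?_
    rw [← Finset.sum_sub_distrib]
    refine Finset.sum_congr rfl fun j _ => ?_
    simp only [hg, hd]; ring
  have hswap : ∑ i, ∑ j, C i j * g i j * d j = -∑ i, ∑ j, C i j * g i j * d i := by
    rw [Finset.sum_comm, ← Finset.sum_neg_distrib]
    refine Finset.sum_congr rfl fun i _ => ?_
    rw [← Finset.sum_neg_distrib]
    refine Finset.sum_congr rfl fun j _ => ?_
    rw [hanti j i]; ring
  rw [hL, hR, hswap]; ring

/-- **Master step**: if the pairing `Σ_i (θ'_i − θ_i)(F_i(θ') − F_i(θ))` is `≤ 0` (e.g. both are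
equilibria for the same injections), the off-diagonal couplings are `≥ 0`, and on every line the
two line angles `x = θ_i − θ_j`, `x' = θ'_i − θ'_j` satisfy the strict sector property
`x' ≠ x → (x' − x)(sin x' − sin x) > 0` (with the non-strict one everywhere), then the two angle
vectors have the same angle across every line.
[cite: DorflerChertkovBullo2013, SI §3.1 Lemma 2 (3), proof (one-to-one on Δ̄_G(π/2))] -/
theorem lineAngles_eq_of_pairing_nonpos (C : Fin n → Fin n → ℝ) (hC : ∀ i j, C i j = C j i)
    (hC0 : ∀ i j, i ≠ j → 0 ≤ C i j) (θ θ' : Fin n → ℝ)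
    (hpair : ∑ i, (θ' i - θ i) * (∑ j, C i j * Real.sin (θ' i - θ' j)
        - ∑ j, C i j * Real.sin (θ i - θ j)) ≤ 0)
    (hsec : ∀ i j, i ≠ j → 0 < C i j →
        0 ≤ ((θ' i - θ' j) - (θ i - θ j)) * (Real.sin (θ' i - θ' j) - Real.sin (θ i - θ j)))
    (hstrict : ∀ i j, i ≠ j → 0 < C i j → θ' i - θ' j ≠ θ i - θ j →
        0 < ((θ' i - θ' j) - (θ i - θ j)) * (Real.sin (θ' i - θ' j) - Real.sin (θ i - θ j))) :
    ∀ i j, i ≠ j → 0 < C i j → θ' i - θ' j = θ i - θ j := by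
  set T : Fin n → Fin n → ℝ := fun i j => C i j * (((θ' i - θ' j) - (θ i - θ j))
      * (Real.sin (θ' i - θ' j) - Real.sin (θ i - θ j))) with hT
  have hTnonneg : ∀ i j, 0 ≤ T i j := by
    intro i j
    by_cases hij : i = j
    · subst hij; simp [hT]
    rcases (hC0 i j hij).eq_or_lt with h0 | hpos
    · simp [hT, ← h0]
    · exact mul_nonneg hpos.le (hsec i j hij hpos)
  have hsum : ∑ i, ∑ j, T i j ≤ 0 := by
    have h := flow_pairing_eq C hC θ θ'
    rw [h] at hpair
    simpa [hT] using (by linarith : ∑ i, ∑ j, C i j * (((θ' i - θ' j) - (θ i - θ j))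
      * (Real.sin (θ' i - θ' j) - Real.sin (θ i - θ j))) ≤ 0)
  have hrow : ∀ i, 0 ≤ ∑ j, T i j := fun i => Finset.sum_nonneg fun j _ => hTnonneg i j
  have hsum0 : ∑ i, ∑ j, T i j = 0 := le_antisymm hsum (Finset.sum_nonneg fun i _ => hrow i)
  have hrow0 : ∀ i, ∑ j, T i j = 0 := by
    intro i
    exact (Finset.sum_eq_zero_iff_of_nonneg fun i _ => hrow i).mp hsum0 i (Finset.mem_univ i)
  have hT0 : ∀ i j, T i j = 0 := by
    intro i j
    exact (Finset.sum_eq_zero_iff_of_nonneg fun j _ => hTnonneg i j).mp (hrow0 i) j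
      (Finset.mem_univ j)
  intro i j hij hpos
  by_contra hne
  have h1 := hstrict i j hij hpos hne
  have h2 : T i j = 0 := hT0 i j
  have : 0 < T i j := mul_pos hpos h1
  linarith

/-- **Uniqueness of line angles in the closed phase-cohesive polytope** [DCB 2013 SI Lemma 2 (3)
⇐ AraposthatisSastryVaraiya1981 Cor. 1; DvijothamLowChertkov2015 Cor. 1]: two synchronous
equilibria `F(θ) = P = F(θ')` of a lossless network (symmetric couplings, off-diagonal `≥ 0`) with
`|θ_i − θ_j| ≤ π/2` and `|θ'_i − θ'_j| ≤ π/2` across every line have the same angle across every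
line.  (No connectivity hypothesis is needed for this form.)
[cite: DorflerChertkovBullo2013, SI §3.1 Lemma 2 (3)] -/
theorem lineAngles_eq_of_equilibria_phaseCohesive (C : Fin n → Fin n → ℝ) (P : Fin n → ℝ)
    (hC : ∀ i j, C i j = C j i) (hC0 : ∀ i j, i ≠ j → 0 ≤ C i j) (θ θ' : Fin n → ℝ)
    (hθ : ∀ i, ∑ j, C i j * Real.sin (θ i - θ j) = P i)
    (hθ' : ∀ i, ∑ j, C i j * Real.sin (θ' i - θ' j) = P i)
    (hcoh : ∀ i j, i ≠ j → 0 < C i j → |θ i - θ j| ≤ π / 2)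
    (hcoh' : ∀ i j, i ≠ j → 0 < C i j → |θ' i - θ' j| ≤ π / 2) :
    ∀ i j, i ≠ j → 0 < C i j → θ' i - θ' j = θ i - θ j := by
  refine lineAngles_eq_of_pairing_nonpos C hC hC0 θ θ' ?_ ?_ ?_
  · apply le_of_eq
    refine Finset.sum_eq_zero fun i _ => ?_
    rw [hθ i, hθ' i]; ring
  · intro i j hij hpos
    exact SinusoidalCoupling.sub_mul_sin_sub_nonneg (hcoh i j hij hpos) (hcoh' i j hij hpos)
  · intro i j hij hpos hne
    exact SinusoidalCoupling.sub_mul_sin_sub_pos (hcoh i j hij hpos) (hcoh' i j hij hpos)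
      (Ne.symm hne)

/-- **Uniqueness of line angles in Vu–Turitsyn's polytope around an s.e.p.** [VuTuritsyn2016
App. 9.2: inside `P = {|δ_kj + δ*_kj| < π}` the only stationary point is `δ*`]: if `θ*` is an
equilibrium with `|θ*_i − θ*_j| < π/2` across lines and `θ` is an equilibrium (same injections)
with `|(θ_i − θ_j) + (θ*_i − θ*_j)| < π` across lines, then `θ` has the same line angles as `θ*`.
[cite: VuTuritsyn2016, §IV polytope P and App. 9.2] -/
theorem lineAngles_eq_of_equilibria_sectorPolytope (C : Fin n → Fin n → ℝ) (P : Fin n → ℝ)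
    (hC : ∀ i j, C i j = C j i) (hC0 : ∀ i j, i ≠ j → 0 ≤ C i j) (θs θ : Fin n → ℝ)
    (hθs : ∀ i, ∑ j, C i j * Real.sin (θs i - θs j) = P i)
    (hθ : ∀ i, ∑ j, C i j * Real.sin (θ i - θ j) = P i)
    (hsep : ∀ i j, i ≠ j → 0 < C i j → |θs i - θs j| < π / 2)
    (hP : ∀ i j, i ≠ j → 0 < C i j → |(θ i - θ j) + (θs i - θs j)| < π) :
    ∀ i j, i ≠ j → 0 < C i j → θ i - θ j = θs i - θs j := by
  refine lineAngles_eq_of_pairing_nonpos C hC hC0 θs θ ?_ ?_ ?_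
  · apply le_of_eq
    refine Finset.sum_eq_zero fun i _ => ?_
    rw [hθ i, hθs i]; ring
  · intro i j hij hpos
    exact SinusoidalCoupling.sector_nonneg (hsep i j hij hpos).le (hP i j hij hpos).le
  · intro i j hij hpos hne
    exact SinusoidalCoupling.sector_pos_of_abs_add_lt (hsep i j hij hpos) (hP i j hij hpos) hne

/-! ## From equal line angles to a uniform rotation: connectivity -/

/-- Connectivity of the coupling graph `{(i,j) : 0 < C i j}`, spelled as the cut condition the
proof uses: every nonempty vertex set with nonempty complement has a line leaving it.
[cite: DorflerChertkovBullo2013, SI §3.1 Lemma 2, hypothesis «connected graph G(V,E,A)»] -/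
def CouplingConnected (C : Fin n → Fin n → ℝ) : Prop :=
  ∀ S : Finset (Fin n), S.Nonempty → Sᶜ.Nonempty → ∃ i ∈ S, ∃ j ∈ Sᶜ, 0 < C i j

/-- Unfolding of `CouplingConnected` (cut form of «connected graph»).
[cite: DorflerChertkovBullo2013, SI §3.1 Lemma 2, hypothesis «connected graph G(V,E,A)»] -/
theorem couplingConnected_def (C : Fin n → Fin n → ℝ) :
    CouplingConnected C ↔
      ∀ S : Finset (Fin n), S.Nonempty → Sᶜ.Nonempty → ∃ i ∈ S, ∃ j ∈ Sᶜ, 0 < C i j := Iff.rfl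

/-- On a connected coupling graph, equal angles across every line means a uniform rotation (the
«rotational symmetry» / nullspace `𝟙ₙ` of the printed proof).
[cite: DorflerChertkovBullo2013, SI §3.1 Lemma 2, proof of 2)–3) (nullspace 𝟙ₙ, rotational symmetry)] -/
theorem exists_const_of_lineAngles_eq {C : Fin n → Fin n → ℝ} (hconn : CouplingConnected C)
    {θ θ' : Fin n → ℝ} (h : ∀ i j, i ≠ j → 0 < C i j → θ' i - θ' j = θ i - θ j) :
    ∃ c : ℝ, ∀ i, θ' i = θ i + c := by
  rcases isEmpty_or_nonempty (Fin n) with hn | ⟨⟨i₀⟩⟩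
  · exact ⟨0, fun i => (IsEmpty.false i).elim⟩
  refine ⟨θ' i₀ - θ i₀, ?_⟩
  classical
  set S : Finset (Fin n) := Finset.univ.filter fun i => θ' i - θ i = θ' i₀ - θ i₀ with hS
  by_contra hnot
  obtain ⟨k, hk⟩ := not_forall.mp hnot
  have hSne : S.Nonempty := ⟨i₀, by simp [hS]⟩
  have hSc : Sᶜ.Nonempty := ⟨k, by simp [hS]; intro h'; exact hk (by linarith)⟩
  obtain ⟨i, hi, j, hj, hij⟩ := hconn S hSne hSc
  have hne : i ≠ j := by rintro rfl; simp at hj; exact hj hi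
  have hline := h i j hne hij
  have hi' : θ' i - θ i = θ' i₀ - θ i₀ := by simpa [hS] using hi
  have hj' : ¬ θ' j - θ j = θ' i₀ - θ i₀ := by simpa [hS] using hj
  exact hj' (by linarith)

/-- **Statement 3) as printed — the equilibrium is unique modulo a uniform rotation**: on a
connected lossless network, two synchronous equilibria in the closed phase-cohesive polytope
`Δ̄_G(π/2)` (real line differences `≤ π/2`) differ by a constant shift of all angles.
[cite: DorflerChertkovBullo2013, SI §3.1 Lemma 2 (3)] -/
theorem equilibrium_unique_mod_rotation (C : Fin n → Fin n → ℝ) (P : Fin n → ℝ)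
    (hC : ∀ i j, C i j = C j i) (hC0 : ∀ i j, i ≠ j → 0 ≤ C i j) (hconn : CouplingConnected C)
    (θ θ' : Fin n → ℝ)
    (hθ : ∀ i, ∑ j, C i j * Real.sin (θ i - θ j) = P i)
    (hθ' : ∀ i, ∑ j, C i j * Real.sin (θ' i - θ' j) = P i)
    (hcoh : ∀ i j, i ≠ j → 0 < C i j → |θ i - θ j| ≤ π / 2)
    (hcoh' : ∀ i j, i ≠ j → 0 < C i j → |θ' i - θ' j| ≤ π / 2) :
    ∃ c : ℝ, ∀ i, θ' i = θ i + c :=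
  exists_const_of_lineAngles_eq hconn
    (lineAngles_eq_of_equilibria_phaseCohesive C P hC hC0 θ θ' hθ hθ' hcoh hcoh')

/-- **Reference-angle form** [DvijothamLowChertkov2015 Cor. 1, «θ_S = 0 … the power flow
solution, if it exists, is unique»]: with one angle pinned, the equilibrium in `Δ̄_G(π/2)` of a
connected lossless network is unique. [cite: DvijothamLowChertkov2015, §3.3 Cor. 1] -/
theorem equilibrium_unique_of_reference (C : Fin n → Fin n → ℝ) (P : Fin n → ℝ)
    (hC : ∀ i j, C i j = C j i) (hC0 : ∀ i j, i ≠ j → 0 ≤ C i j) (hconn : CouplingConnected C)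
    (θ θ' : Fin n → ℝ)
    (hθ : ∀ i, ∑ j, C i j * Real.sin (θ i - θ j) = P i)
    (hθ' : ∀ i, ∑ j, C i j * Real.sin (θ' i - θ' j) = P i)
    (hcoh : ∀ i j, i ≠ j → 0 < C i j → |θ i - θ j| ≤ π / 2)
    (hcoh' : ∀ i j, i ≠ j → 0 < C i j → |θ' i - θ' j| ≤ π / 2)
    (r : Fin n) (hr : θ' r = θ r) : θ' = θ := by
  obtain ⟨c, hc⟩ := equilibrium_unique_mod_rotation C P hC hC0 hconn θ θ' hθ hθ' hcoh hcoh'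
  have hc0 : c = 0 := by have := hc r; linarith
  funext i
  rw [hc i, hc0, add_zero]

/-- The same for Vu–Turitsyn's polytope: an equilibrium `θ` with `|(θ_i−θ_j) + (θ*_i−θ*_j)| < π`
across lines is a uniform rotation of the s.e.p. `θ*` (connected network).
[cite: VuTuritsyn2016, App. 9.2] -/
theorem equilibrium_unique_mod_rotation_sectorPolytope (C : Fin n → Fin n → ℝ) (P : Fin n → ℝ)
    (hC : ∀ i j, C i j = C j i) (hC0 : ∀ i j, i ≠ j → 0 ≤ C i j) (hconn : CouplingConnected C)
    (θs θ : Fin n → ℝ)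
    (hθs : ∀ i, ∑ j, C i j * Real.sin (θs i - θs j) = P i)
    (hθ : ∀ i, ∑ j, C i j * Real.sin (θ i - θ j) = P i)
    (hsep : ∀ i j, i ≠ j → 0 < C i j → |θs i - θs j| < π / 2)
    (hP : ∀ i j, i ≠ j → 0 < C i j → |(θ i - θ j) + (θs i - θs j)| < π) :
    ∃ c : ℝ, ∀ i, θ i = θs i + c :=
  exists_const_of_lineAngles_eq hconn
    (lineAngles_eq_of_equilibria_sectorPolytope C P hC hC0 θs θ hθs hθ hsep hP)

/-! ## Networks with infinite (pinned) buses: uniqueness outright -/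

/-- Pairing identity with `m` pinned buses at angles `β` (couplings `K i b ≥ 0`): the machine–bus
terms contribute `Σ_i Σ_b K_ib (θ'_i − θ_i)(sin(θ'_i − β_b) − sin(θ_i − β_b))` (a pinned bus is the
printed slack bus `θ_S = 0`). [cite: DvijothamLowChertkov2015, §3.3 Cor. 1 (slack bus pinned, θ_S = 0)] -/
theorem flow_pairing_eq_withInfiniteBuses (C : Fin n → Fin n → ℝ) (hC : ∀ i j, C i j = C j i)
    (K : Fin n → Fin m → ℝ) (β : Fin m → ℝ) (θ θ' : Fin n → ℝ) :
    ∑ i, (θ' i - θ i) *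
        ((∑ j, C i j * Real.sin (θ' i - θ' j) + ∑ b, K i b * Real.sin (θ' i - β b))
          - (∑ j, C i j * Real.sin (θ i - θ j) + ∑ b, K i b * Real.sin (θ i - β b)))
      = 1 / 2 * ∑ i, ∑ j, C i j * (((θ' i - θ' j) - (θ i - θ j))
          * (Real.sin (θ' i - θ' j) - Real.sin (θ i - θ j)))
        + ∑ i, ∑ b, K i b * (((θ' i - β b) - (θ i - β b))
          * (Real.sin (θ' i - β b) - Real.sin (θ i - β b))) := by
  have h := flow_pairing_eq C hC θ θ'
  have hsplit : ∑ i, (θ' i - θ i) *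
        ((∑ j, C i j * Real.sin (θ' i - θ' j) + ∑ b, K i b * Real.sin (θ' i - β b))
          - (∑ j, C i j * Real.sin (θ i - θ j) + ∑ b, K i b * Real.sin (θ i - β b)))
      = ∑ i, (θ' i - θ i) * (∑ j, C i j * Real.sin (θ' i - θ' j)
          - ∑ j, C i j * Real.sin (θ i - θ j))
        + ∑ i, (θ' i - θ i) * (∑ b, K i b * Real.sin (θ' i - β b)
          - ∑ b, K i b * Real.sin (θ i - β b)) := by
    rw [← Finset.sum_add_distrib]
    refine Finset.sum_congr rfl fun i _ => ?_
    ring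
  have hbus : ∑ i, (θ' i - θ i) * (∑ b, K i b * Real.sin (θ' i - β b)
      - ∑ b, K i b * Real.sin (θ i - β b))
      = ∑ i, ∑ b, K i b * (((θ' i - β b) - (θ i - β b))
          * (Real.sin (θ' i - β b) - Real.sin (θ i - β b))) := by
    refine Finset.sum_congr rfl fun i _ => ?_
    rw [← Finset.sum_sub_distrib, Finset.mul_sum]
    refine Finset.sum_congr rfl fun b _ => ?_
    ring
  rw [hsplit, h, hbus]

/-- **Equal line angles and fixed bus-coupled angles** for two equilibria of a lossless network
with infinite buses, both in the closed phase-cohesive polytope (machine–machine lines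
`|θ_i − θ_j| ≤ π/2`, machine–bus lines `|θ_i − β_b| ≤ π/2`): the machine–machine line angles agree
and every machine coupled to a bus has the same angle in both.
[cite: DorflerChertkovBullo2013, SI §3.1 Lemma 2 (3)] -/
theorem lineAngles_eq_of_equilibria_phaseCohesive_withInfiniteBuses
    (C : Fin n → Fin n → ℝ) (K : Fin n → Fin m → ℝ) (β : Fin m → ℝ) (P : Fin n → ℝ)
    (hC : ∀ i j, C i j = C j i) (hC0 : ∀ i j, i ≠ j → 0 ≤ C i j) (hK0 : ∀ i b, 0 ≤ K i b)
    (θ θ' : Fin n → ℝ)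
    (hθ : ∀ i, ∑ j, C i j * Real.sin (θ i - θ j) + ∑ b, K i b * Real.sin (θ i - β b) = P i)
    (hθ' : ∀ i, ∑ j, C i j * Real.sin (θ' i - θ' j) + ∑ b, K i b * Real.sin (θ' i - β b) = P i)
    (hcoh : ∀ i j, i ≠ j → 0 < C i j → |θ i - θ j| ≤ π / 2)
    (hcoh' : ∀ i j, i ≠ j → 0 < C i j → |θ' i - θ' j| ≤ π / 2)
    (hcohK : ∀ i b, 0 < K i b → |θ i - β b| ≤ π / 2)
    (hcohK' : ∀ i b, 0 < K i b → |θ' i - β b| ≤ π / 2) :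
    (∀ i j, i ≠ j → 0 < C i j → θ' i - θ' j = θ i - θ j) ∧
      (∀ i b, 0 < K i b → θ' i = θ i) := by
  -- both blocks of the pairing are termwise ≥ 0 and the total is 0
  set T : Fin n → Fin n → ℝ := fun i j => C i j * (((θ' i - θ' j) - (θ i - θ j))
      * (Real.sin (θ' i - θ' j) - Real.sin (θ i - θ j))) with hT
  set U : Fin n → Fin m → ℝ := fun i b => K i b * (((θ' i - β b) - (θ i - β b))
      * (Real.sin (θ' i - β b) - Real.sin (θ i - β b))) with hU
  have hTnonneg : ∀ i j, 0 ≤ T i j := by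
    intro i j
    by_cases hij : i = j
    · subst hij; simp [hT]
    rcases (hC0 i j hij).eq_or_lt with h0 | hpos
    · simp [hT, ← h0]
    · exact mul_nonneg hpos.le
        (SinusoidalCoupling.sub_mul_sin_sub_nonneg (hcoh i j hij hpos) (hcoh' i j hij hpos))
  have hUnonneg : ∀ i b, 0 ≤ U i b := by
    intro i b
    rcases (hK0 i b).eq_or_lt with h0 | hpos
    · simp [hU, ← h0]
    · exact mul_nonneg hpos.le
        (SinusoidalCoupling.sub_mul_sin_sub_nonneg (hcohK i b hpos) (hcohK' i b hpos))
  have htot : 1 / 2 * ∑ i, ∑ j, T i j + ∑ i, ∑ b, U i b = 0 := by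
    have h := flow_pairing_eq_withInfiniteBuses C hC K β θ θ'
    have h0 : ∑ i, (θ' i - θ i) *
        ((∑ j, C i j * Real.sin (θ' i - θ' j) + ∑ b, K i b * Real.sin (θ' i - β b))
          - (∑ j, C i j * Real.sin (θ i - θ j) + ∑ b, K i b * Real.sin (θ i - β b))) = 0 := by
      refine Finset.sum_eq_zero fun i _ => ?_
      rw [hθ i, hθ' i]; ring
    rw [h0] at h
    simpa [hT, hU] using h.symm
  have hTsum : 0 ≤ ∑ i, ∑ j, T i j :=
    Finset.sum_nonneg fun i _ => Finset.sum_nonneg fun j _ => hTnonneg i j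
  have hUsum : 0 ≤ ∑ i, ∑ b, U i b :=
    Finset.sum_nonneg fun i _ => Finset.sum_nonneg fun b _ => hUnonneg i b
  have hT0 : ∑ i, ∑ j, T i j = 0 := by linarith
  have hU0 : ∑ i, ∑ b, U i b = 0 := by linarith
  have hTij : ∀ i j, T i j = 0 := by
    intro i j
    have hrow := (Finset.sum_eq_zero_iff_of_nonneg fun i _ =>
      Finset.sum_nonneg fun j _ => hTnonneg i j).mp hT0 i (Finset.mem_univ i)
    exact (Finset.sum_eq_zero_iff_of_nonneg fun j _ => hTnonneg i j).mp hrow j (Finset.mem_univ j)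
  have hUib : ∀ i b, U i b = 0 := by
    intro i b
    have hrow := (Finset.sum_eq_zero_iff_of_nonneg fun i _ =>
      Finset.sum_nonneg fun b _ => hUnonneg i b).mp hU0 i (Finset.mem_univ i)
    exact (Finset.sum_eq_zero_iff_of_nonneg fun b _ => hUnonneg i b).mp hrow b (Finset.mem_univ b)
  constructor
  · intro i j hij hpos
    by_contra hne
    have h1 := SinusoidalCoupling.sub_mul_sin_sub_pos (hcoh i j hij hpos) (hcoh' i j hij hpos)
      (Ne.symm hne)
    have : 0 < T i j := mul_pos hpos h1
    linarith [hTij i j]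
  · intro i b hpos
    by_contra hne
    have hne' : θ i - β b ≠ θ' i - β b := by intro h; apply hne; linarith
    have h1 := SinusoidalCoupling.sub_mul_sin_sub_pos (hcohK i b hpos) (hcohK' i b hpos) hne'
    have : 0 < U i b := mul_pos hpos h1
    linarith [hUib i b]

/-- Connectivity of the machine graph THROUGH the buses, as the cut condition the proof uses:
every nonempty set of machines has a line to a machine outside it or to an infinite bus
(connected network containing the slack / infinite bus).
[cite: DvijothamLowChertkov2015, §3.3 Cor. 1 (slack bus pinned, θ_S = 0); DorflerChertkovBullo2013, SI §3.1 Lemma 2 (hypothesis «connected graph»)] -/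
def CouplingConnectedToBus (C : Fin n → Fin n → ℝ) (K : Fin n → Fin m → ℝ) : Prop :=
  ∀ S : Finset (Fin n), S.Nonempty → ∃ i ∈ S, (∃ j ∈ Sᶜ, 0 < C i j) ∨ (∃ b, 0 < K i b)

/-- Unfolding of `CouplingConnectedToBus`.
[cite: DvijothamLowChertkov2015, §3.3 Cor. 1 (slack bus pinned, θ_S = 0)] -/
theorem couplingConnectedToBus_def (C : Fin n → Fin n → ℝ) (K : Fin n → Fin m → ℝ) :
    CouplingConnectedToBus C K ↔
      ∀ S : Finset (Fin n), S.Nonempty → ∃ i ∈ S, (∃ j ∈ Sᶜ, 0 < C i j) ∨ (∃ b, 0 < K i b) :=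
  Iff.rfl

/-- Equal line angles plus fixed bus-coupled angles force equality on a network connected through
its buses (no rotational freedom once a bus angle is pinned).
[cite: DvijothamLowChertkov2015, §3.3 Cor. 1 (slack bus pinned, θ_S = 0)] -/
theorem eq_of_lineAngles_eq_withInfiniteBuses {C : Fin n → Fin n → ℝ} {K : Fin n → Fin m → ℝ}
    (hconn : CouplingConnectedToBus C K) {θ θ' : Fin n → ℝ}
    (hline : ∀ i j, i ≠ j → 0 < C i j → θ' i - θ' j = θ i - θ j)
    (hbus : ∀ i b, 0 < K i b → θ' i = θ i) : θ' = θ := by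
  classical
  set S : Finset (Fin n) := Finset.univ.filter fun i => θ' i ≠ θ i with hS
  by_contra hneq
  have hSne : S.Nonempty := by
    by_contra hS0
    apply hneq
    funext i
    by_contra hi
    exact hS0 ⟨i, by simp [hS, hi]⟩
  obtain ⟨i, hi, hcase⟩ := hconn S hSne
  have hi' : θ' i ≠ θ i := by simpa [hS] using hi
  rcases hcase with ⟨j, hj, hij⟩ | ⟨b, hb⟩
  · have hne : i ≠ j := by rintro rfl; simp at hj; exact hj hi
    have hj' : θ' j = θ j := by simpa [hS] using hj
    have := hline i j hne hij
    exact hi' (by linarith)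
  · exact hi' (hbus i b hb)

/-- **Unique equilibrium with infinite buses** — the `n`-machine form of the `∃!` proved for
Chiang's three-machine system in `ChiangThreeMachineRegionOfAttraction.lean`: a lossless network
of `n` machines and `m` infinite buses, connected through its buses, has at most one synchronous
equilibrium in the closed phase-cohesive polytope (all line differences, machine–machine and
machine–bus, `≤ π/2` as real numbers). [cite: DorflerChertkovBullo2013, SI §3.1 Lemma 2 (3)] -/
theorem equilibrium_unique_withInfiniteBuses
    (C : Fin n → Fin n → ℝ) (K : Fin n → Fin m → ℝ) (β : Fin m → ℝ) (P : Fin n → ℝ)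
    (hC : ∀ i j, C i j = C j i) (hC0 : ∀ i j, i ≠ j → 0 ≤ C i j) (hK0 : ∀ i b, 0 ≤ K i b)
    (hconn : CouplingConnectedToBus C K) (θ θ' : Fin n → ℝ)
    (hθ : ∀ i, ∑ j, C i j * Real.sin (θ i - θ j) + ∑ b, K i b * Real.sin (θ i - β b) = P i)
    (hθ' : ∀ i, ∑ j, C i j * Real.sin (θ' i - θ' j) + ∑ b, K i b * Real.sin (θ' i - β b) = P i)
    (hcoh : ∀ i j, i ≠ j → 0 < C i j → |θ i - θ j| ≤ π / 2)
    (hcoh' : ∀ i j, i ≠ j → 0 < C i j → |θ' i - θ' j| ≤ π / 2)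
    (hcohK : ∀ i b, 0 < K i b → |θ i - β b| ≤ π / 2)
    (hcohK' : ∀ i b, 0 < K i b → |θ' i - β b| ≤ π / 2) : θ' = θ := by
  obtain ⟨hline, hbus⟩ := lineAngles_eq_of_equilibria_phaseCohesive_withInfiniteBuses C K β P
    hC hC0 hK0 θ θ' hθ hθ' hcoh hcoh' hcohK hcohK'
  exact eq_of_lineAngles_eq_withInfiniteBuses hconn hline hbus

/-! ## Statement 1): the negative Jacobian is a weighted Laplacian form, PSD on `Δ̄_G(π/2)` -/

/-- **Jacobian quadratic form** [DCB 2013 SI Lemma 2 (1): `J(θ) = −B diag(a_ij cos(θ_i−θ_j)) Bᵀ`],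
in coordinates: for symmetric `C`,
`Σ_i v_i Σ_j C_ij cos(θ_i − θ_j)(v_i − v_j) = ½ Σ_i Σ_j C_ij cos(θ_i − θ_j)(v_i − v_j)²`
(`Σ_j C_ij cos(θ_i−θ_j)(v_i − v_j)` is the directional derivative of `F_i` along `v`).
[cite: DorflerChertkovBullo2013, SI §3.1 Lemma 2 (1)] -/
theorem jacobian_quadraticForm_eq (C : Fin n → Fin n → ℝ) (hC : ∀ i j, C i j = C j i)
    (θ v : Fin n → ℝ) :
    ∑ i, v i * ∑ j, C i j * Real.cos (θ i - θ j) * (v i - v j)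
      = 1 / 2 * ∑ i, ∑ j, C i j * Real.cos (θ i - θ j) * (v i - v j) ^ 2 := by
  set w : Fin n → Fin n → ℝ := fun i j => C i j * Real.cos (θ i - θ j) with hw
  have hsymm : ∀ i j, w i j = w j i := by
    intro i j
    simp only [hw]
    rw [hC i j, show θ j - θ i = -(θ i - θ j) by ring, Real.cos_neg]
  have hL : ∑ i, v i * ∑ j, C i j * Real.cos (θ i - θ j) * (v i - v j)
      = ∑ i, ∑ j, w i j * (v i - v j) * v i := by
    refine Finset.sum_congr rfl fun i _ => ?_
    rw [Finset.mul_sum]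
    refine Finset.sum_congr rfl fun j _ => ?_
    simp only [hw]; ring
  have hR : 1 / 2 * ∑ i, ∑ j, C i j * Real.cos (θ i - θ j) * (v i - v j) ^ 2
      = 1 / 2 * (∑ i, ∑ j, w i j * (v i - v j) * v i - ∑ i, ∑ j, w i j * (v i - v j) * v j) := by
    congr 1
    rw [← Finset.sum_sub_distrib]
    refine Finset.sum_congr rfl fun i _ => ?_
    rw [← Finset.sum_sub_distrib]
    refine Finset.sum_congr rfl fun j _ => ?_
    simp only [hw]; ring
  have hswap : ∑ i, ∑ j, w i j * (v i - v j) * v j = -∑ i, ∑ j, w i j * (v i - v j) * v i := by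
    rw [Finset.sum_comm, ← Finset.sum_neg_distrib]
    refine Finset.sum_congr rfl fun i _ => ?_
    rw [← Finset.sum_neg_distrib]
    refine Finset.sum_congr rfl fun j _ => ?_
    rw [hsymm j i]; ring
  rw [hL, hR, hswap]; ring

/-- … and it is nonnegative on the closed phase-cohesive polytope (off-diagonal couplings `≥ 0`,
`cos(θ_i − θ_j) ≥ 0` across lines): the negative Jacobian is positive semidefinite there.
[cite: DorflerChertkovBullo2013, SI §3.1 Lemma 2 (1)–(2)] -/
theorem jacobian_quadraticForm_nonneg (C : Fin n → Fin n → ℝ) (hC : ∀ i j, C i j = C j i)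
    (hC0 : ∀ i j, i ≠ j → 0 ≤ C i j) (θ v : Fin n → ℝ)
    (hcoh : ∀ i j, i ≠ j → 0 < C i j → |θ i - θ j| ≤ π / 2) :
    0 ≤ ∑ i, v i * ∑ j, C i j * Real.cos (θ i - θ j) * (v i - v j) := by
  rw [jacobian_quadraticForm_eq C hC θ v]
  refine mul_nonneg (by norm_num) (Finset.sum_nonneg fun i _ => Finset.sum_nonneg fun j _ => ?_)
  by_cases hij : i = j
  · subst hij; simp
  rcases (hC0 i j hij).eq_or_lt with h0 | hpos
  · simp [← h0]
  · have hcos : 0 ≤ Real.cos (θ i - θ j) := by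
      apply Real.cos_nonneg_of_mem_Icc
      constructor <;> [linarith [(abs_le.mp (hcoh i j hij hpos)).1];
        linarith [(abs_le.mp (hcoh i j hij hpos)).2]]
    exact mul_nonneg (mul_nonneg hpos.le hcos) (sq_nonneg _)

/-! ## Scope remark, kernel-checked: the torus reading fails on a 5-cycle -/

/- SCOPE EXAMPLE (kernel-checked, not a declaration). The splay state `θ_i = 2πi/5` of five identical oscillators on a ring (unit couplings between
cyclic neighbours, zero injections) IS a synchronous equilibrium: by the symmetry
`sin(2π/5) = sin(−2π/5·(−1))` the two neighbour flows cancel at every node.  Its neighbour gaps are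
`2π/5 < π/2` as geodesic distances, yet it is not a rotation of `θ = 0`; as a real lift its closing
line has `|θ_4 − θ_0| = 8π/5 > π/2`, outside the hypotheses above. -/
example :
    let C : Fin 5 → Fin 5 → ℝ := fun i j =>
      if (j.val + 1) % 5 = i.val ∨ (i.val + 1) % 5 = j.val then 1 else 0
    let θ : Fin 5 → ℝ := fun i => 2 * π * i.val / 5
    (∀ i, ∑ j, C i j * Real.sin (θ i - θ j) = 0) ∧ (∀ i j, C i j = C j i) ∧
      |θ 4 - θ 0| > π / 2 ∧ ¬ ∃ c : ℝ, ∀ i, θ i = 0 + c := by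
  refine ⟨?_, ?_, ?_, ?_⟩
  · have hper : Real.sin (2 * π * 4 / 5) = -Real.sin (2 * π / 5) := by
      rw [show 2 * π * 4 / 5 = 2 * π - 2 * π / 5 by ring, Real.sin_two_pi_sub]
    have e12 : Real.sin (2 * π / 5 - 2 * π * 2 / 5) = -Real.sin (2 * π / 5) := by
      rw [show 2 * π / 5 - 2 * π * 2 / 5 = -(2 * π / 5) by ring, Real.sin_neg]
    have e21 : Real.sin (2 * π * 2 / 5 - 2 * π / 5) = Real.sin (2 * π / 5) := by
      rw [show 2 * π * 2 / 5 - 2 * π / 5 = 2 * π / 5 by ring]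
    have e23 : Real.sin (2 * π * 2 / 5 - 2 * π * 3 / 5) = -Real.sin (2 * π / 5) := by
      rw [show 2 * π * 2 / 5 - 2 * π * 3 / 5 = -(2 * π / 5) by ring, Real.sin_neg]
    have e32 : Real.sin (2 * π * 3 / 5 - 2 * π * 2 / 5) = Real.sin (2 * π / 5) := by
      rw [show 2 * π * 3 / 5 - 2 * π * 2 / 5 = 2 * π / 5 by ring]
    have e34 : Real.sin (2 * π * 3 / 5 - 2 * π * 4 / 5) = -Real.sin (2 * π / 5) := by
      rw [show 2 * π * 3 / 5 - 2 * π * 4 / 5 = -(2 * π / 5) by ring, Real.sin_neg]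
    have e43 : Real.sin (2 * π * 4 / 5 - 2 * π * 3 / 5) = Real.sin (2 * π / 5) := by
      rw [show 2 * π * 4 / 5 - 2 * π * 3 / 5 = 2 * π / 5 by ring]
    intro i
    fin_cases i <;> simp [Fin.sum_univ_five, e12, e21, e23, e32, e34, e43, hper]
  · intro i j
    fin_cases i <;> fin_cases j <;> simp
  · simp only [Fin.val_zero]
    rw [show (2 : ℝ) * π * (4 : Fin 5).val / 5 - 2 * π * (0 : ℕ) / 5 = 8 * π / 5 by
      simp; ring]
    rw [abs_of_pos (by positivity)]
    linarith [Real.pi_pos]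
  · rintro ⟨c, hc⟩
    have h0 := hc 0
    have h1 := hc 1
    simp at h0 h1
    have : (2 : ℝ) * π / 5 = 0 := by linarith
    linarith [Real.pi_pos]

end ClassicalModel

/-! ## Corollary for the Bergen–Hill record of `StructurePreservingModel.lean` -/

namespace BergenHill

variable {n : ℕ}

/-- **Bergen–Hill structure-preserving model: the synchronous equilibrium in the closed
phase-cohesive polytope is unique modulo rotation** (symmetric susceptance weights `b ≥ 0`
off the diagonal, connected network). [cite: DorflerChertkovBullo2013, SI §3.1 Lemma 2 (3)] -/
theorem isEquilibrium_unique_mod_rotation (S : BergenHill n) (hb : ∀ i j, S.b i j = S.b j i)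
    (hb0 : ∀ i j, i ≠ j → 0 ≤ S.b i j) (hconn : ClassicalModel.CouplingConnected S.b)
    {δ0 δ1 : Fin n → ℝ} (h0 : S.IsEquilibrium δ0) (h1 : S.IsEquilibrium δ1)
    (hcoh0 : ∀ i j, i ≠ j → 0 < S.b i j → |δ0 i - δ0 j| ≤ π / 2)
    (hcoh1 : ∀ i j, i ≠ j → 0 < S.b i j → |δ1 i - δ1 j| ≤ π / 2) :
    ∃ c : ℝ, ∀ i, δ1 i = δ0 i + c :=
  ClassicalModel.equilibrium_unique_mod_rotation S.b S.P0 hb hb0 hconn δ0 δ1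
    (fun i => h0 i) (fun i => h1 i) hcoh0 hcoh1

end BergenHill

end Literature.MathematicalPhysics.PowerSystems
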